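import Literature.Topology.FourManifolds.BandSumUnitFamily
import Literature.Topology.FourManifolds.BandSumUnitSphere
import HarnessLib

/-!
# The unknot is a unit for the connected sum, VI: the band data and the discharge

Topic `Literature/Topology/FourManifolds`; last file of the discharge of the named fact
`Literature.Topology.FourManifolds.Knot.exists_isConnectedSum_unknot_isIsotopic` (`BandSum.lean`):

> **The unknot is a unit for the connected sum** — for every knot `K` there is a knot `K'` which is
> a connected sum `K # O` of `K` and the unknot (`Knot.IsConnectedSum K unknot K'`) and which is
> isotopic to `K`. Rolfsen, *Knots and Links* (1976), §2.G; Burde–Zieschang, *Knots*, §7.A.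

The printed sources treat this as evident from the picture; the formal proof is the explicit
construction of the previous five files. For a flat-arc configuration `C` of (an isotopic copy of)
`K` (`BandSumUnitChart.lean`):

* `FlatArcConfig.bandData : BandData C.K (C.oKnot 1) C.newKnot ∅` — **the band** is the affine
  square `band x = toSphere (λ (x₁ - 1/2), λ x₀)` of the arc plane hanging below the flat arc
  (collar `δ = 1/4`): its left edge line `x₀ = 0` is the arc, its right edge line `x₀ = 1` the flat
  top of the small unknot `O = C.oKnot 1` (`BandSumUnitLoops.lean`), and the result
  `C.newKnot = K # O` (`BandSumUnitFamily.lean`) runs inside the square along the two arcs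
  `lowerArc`, `upperArc` read off from the final mushroom curve `mush λ 1` (`BandSumUnitProfiles.lean`);
  the three orientation clauses are chain-rule computations through `ψ⁻¹ ∘ planeMap`.
* `FlatArcConfig.crossing` — the band meets the splitting sphere `C.sphereS`
  (`BandSumUnitSphere.lean`, the horizontal plane at depth `λ/2`) exactly in its middle segment.
* `FlatArcConfig.isConnectedSum` — `Knot.IsConnectedSum K unknot C.newKnot` for every `K ≃ C.K`,
  with the isotopies `unknot ≃ O` (`unknot_isIsotopic_oKnot_one`) and the splitting
  `isSplitBy_sphereS`;
* `Knot.exists_isConnectedSum_unknot_isIsotopic_holds` — **the discharge**: `K ≃ C.K ≃ C.newKnot`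
  (`FlatArcConfig.exists`, `isIsotopic_newKnot`, transitivity `SphereEmbedding.IsIsotopic.trans_holds`).

## References

* D. Rolfsen, *Knots and Links*, Publish or Perish (1976), §2.G. [Rolfsen1976]
* G. Burde, H. Zieschang, *Knots*, 2nd ed. (2003), §7.A. [BurdeZieschang2003]
* M. W. Hirsch, *Differential Topology* (1976), Ch. 8 §1, Thm. 1.3. [HirschDT1976]

## Design notes

No statement of `BandSum.lean` is modified; the file declares no named facts and uses no `sorry`.
-/

open scoped Manifold ContDiff Topology RealInnerProductSpace Real
open Function Set Metric Module Real

noncomputable section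

namespace Literature.Topology.FourManifolds

/-- Local notation: `𝔼 n` is the model Euclidean space `EuclideanSpace ℝ (Fin n)`. -/
local notation "𝔼 " n:arg => EuclideanSpace ℝ (Fin n)

/-- Local notation: `𝕊 n` is the unit sphere in `EuclideanSpace ℝ (Fin (n + 1))`. -/
local notation "𝕊 " n:arg => (Metric.sphere (0 : EuclideanSpace ℝ (Fin (n + 1))) 1)

attribute [local instance] fact_finrank_euclideanSpace_succ

namespace BandSumUnit

open KnotsInBall

/-! ### Immersed maps of the plane into the sphere -/

/-- A smooth map `g : ℝ² → 𝕊³` whose composite with `𝕊³ ⊆ ℝ⁴` has injective derivative at `x` has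
injective `mfderiv` at `x`. [folklore] -/
theorem injective_mfderiv_of_injective_fderiv_coe {g : 𝔼 2 → 𝕊 3}
    (hg : ContMDiff 𝓘(ℝ, 𝔼 2) (𝓡 3) ∞ g) (x : 𝔼 2)
    (h : Injective (fderiv ℝ (fun q ↦ ((g q : 𝕊 3) : 𝔼 4)) x)) :
    Injective (mfderiv 𝓘(ℝ, 𝔼 2) (𝓡 3) g x) := by
  have hn : (∞ : WithTop ℕ∞) ≠ 0 := by simp
  have h1 : MDifferentiableAt 𝓘(ℝ, 𝔼 2) (𝓡 3) g x := hg.mdifferentiableAt hn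
  have h2 : MDifferentiableAt (𝓡 3) 𝓘(ℝ, 𝔼 4) (Subtype.val : (𝕊 3) → 𝔼 4) (g x) :=
    contMDiff_coe_sphere.mdifferentiableAt hn
  have hcomp : mfderiv 𝓘(ℝ, 𝔼 2) 𝓘(ℝ, 𝔼 4) ((Subtype.val : (𝕊 3) → 𝔼 4) ∘ g) x =
      (mfderiv (𝓡 3) 𝓘(ℝ, 𝔼 4) (Subtype.val : (𝕊 3) → 𝔼 4) (g x)).comp
        (mfderiv 𝓘(ℝ, 𝔼 2) (𝓡 3) g x) := mfderiv_comp x h2 h1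
  have e : ∀ u, fderiv ℝ (fun q ↦ ((g q : 𝕊 3) : 𝔼 4)) x u =
      mfderiv (𝓡 3) 𝓘(ℝ, 𝔼 4) (Subtype.val : (𝕊 3) → 𝔼 4) (g x) (mfderiv 𝓘(ℝ, 𝔼 2) (𝓡 3) g x u) := by
    intro u
    rw [← mfderiv_eq_fderiv, show (fun q ↦ ((g q : 𝕊 3) : 𝔼 4)) = Subtype.val ∘ g from rfl, hcomp]
    rfl
  intro v w hvw
  apply h
  rw [e, e, hvw]

/-! ### The D-loop: the two kinds of its points -/

/-- `uAt` is strictly increasing. [folklore] -/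
theorem strictMono_uAt {L : ℝ} (hL : 0 < L) : StrictMono (uAt L) := fun _ _ h ↦ (uAt_lt_uAt hL).2 h

/-- `pt2` is additive. [folklore] -/
theorem pt2_add (a b c d : ℝ) : pt2 a b + pt2 c d = pt2 (a + c) (b + d) := by
  ext i; fin_cases i <;> rfl

/-- Scalar multiples of `pt2`. [folklore] -/
theorem smul_pt2 (r a b : ℝ) : r • pt2 a b = pt2 (r * a) (r * b) := by
  ext i; fin_cases i <;> rfl

/-- `sin ψ > 1/2` on `(π - φ_L, φ_L)`. [folklore] -/
theorem one_half_lt_sin_of_mem {ψ : ℝ} (hψ : ψ ∈ Ioo (π - phiL) phiL) : 1 / 2 < sin ψ := by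
  have hφ := pi_div_two_lt_phiL; have hφ' := phiL_lt_pi
  rcases le_or_gt ψ (π / 2) with h | h
  · have : sin (π - phiL) < sin ψ :=
      sin_lt_sin_of_lt_of_le_pi_div_two (by linarith) h hψ.1
    rw [sin_pi_sub] at this; linarith [one_half_lt_sin_phiL]
  · have : sin (π - phiL) < sin (π - ψ) :=
      sin_lt_sin_of_lt_of_le_pi_div_two (by linarith) (by linarith) (by linarith [hψ.2])
    rw [sin_pi_sub, sin_pi_sub] at this; linarith [one_half_lt_sin_phiL]

/-- **Dichotomy for points of the D-loop** at scale `L`: a point `dloop L 1 φ` is either a point of the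
final mushroom curve between the corner parameters, `mush L 1 u` with `u ∈ [s*, -s*]`, or a point of
the open flat top inside the band square (`|L cos φ| < 3L/4`, `sin φ > 1/2`). [folklore] -/
theorem dloop_one_dichotomy {L : ℝ} (hL : 0 < L) (φ : ℝ) :
    (∃ u ∈ Icc (sStar L) (-sStar L), dloop L 1 φ = mush L 1 u) ∨ (|L * cos φ| < 3 * L / 4 ∧ 1 / 2 < sin φ) := by
  -- reduce modulo `2π` into `[φ_L, φ_L + 2π)`
  set φ' := toIcoMod two_pi_pos phiL φ with hφ'
  have hmem : φ' ∈ Ico phiL (phiL + 2 * π) := toIcoMod_mem_Ico _ _ _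
  have hper : ∃ n : ℤ, φ' = φ - n * (2 * π) := by
    refine ⟨toIcoDiv two_pi_pos phiL φ, ?_⟩
    rw [hφ', toIcoMod, zsmul_eq_mul]
  obtain ⟨n, hn⟩ := hper
  have hcos : cos φ' = cos φ := by rw [hn, cos_sub_int_mul_two_pi]
  have hsin : sin φ' = sin φ := by rw [hn, sin_sub_int_mul_two_pi]
  have hdl : dloop L 1 φ' = dloop L 1 φ := by
    rw [hn, show φ - n * (2 * π) = φ + (-n : ℤ) * (2 * π) by push_cast; ring, dloop_add_int_mul]
  have hq : uAt L (3 * π - phiL) = L / 4 := by rw [← ang_quarter hL, uAt_ang hL]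
  by_cases h : φ' ≤ 3 * π - phiL
  · left
    have h1 : uAt L phiL ≤ uAt L φ' := (strictMono_uAt hL).le_iff_le.2 hmem.1
    have h2 : uAt L φ' ≤ uAt L (3 * π - phiL) := (strictMono_uAt hL).le_iff_le.2 h
    rw [uAt_phiL hL] at h1
    rw [hq] at h2
    refine ⟨uAt L φ', ⟨?_, ?_⟩, ?_⟩
    · rw [sStar]; exact h1
    · rw [sStar, neg_neg]; exact h2
    · have hu : uAt L φ' ∈ Icc (u1 L) (-u1 L) := by
        have := u1_lt_sStar hL
        rw [sStar] at this
        exact ⟨by linarith, by linarith⟩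
      rw [mush_one_eq_dloop hL hu, ang_uAt hL, hdl]
  · right
    push Not at h
    have hψ : φ' - 2 * π ∈ Ioo (π - phiL) phiL := ⟨by linarith, by linarith [hmem.2]⟩
    have hs : 1 / 2 < sin φ := by
      rw [← hsin, ← sin_sub_two_pi]; exact one_half_lt_sin_of_mem hψ
    have hc : |cos φ| < 3 / 4 := by
      rw [← hcos, ← cos_sub_two_pi, abs_lt]
      have h1 : cos (φ' - 2 * π) < cos (π - phiL) :=
        cos_lt_cos_of_nonneg_of_le_pi (by linarith [phiL_lt_pi]) (by linarith [hmem.2, phiL_lt_pi]) hψ.1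
      have h2 : cos phiL < cos (φ' - 2 * π) :=
        cos_lt_cos_of_nonneg_of_le_pi (by linarith [phiL_lt_pi]) phiL_lt_pi.le hψ.2
      rw [cos_pi_sub, cos_phiL] at h1; rw [cos_phiL] at h2
      exact ⟨by linarith, by linarith⟩
    refine ⟨?_, hs⟩
    rw [abs_mul, abs_of_pos hL]; nlinarith

namespace FlatArcConfig

variable (C : FlatArcConfig)

/-! ### The affine square of the band -/

/-- **The affine parametrisation of the band region**: `aff (x₀, x₁) = (λ (x₁ - 1/2), λ x₀)` — the
band coordinate `x₁` runs along the arc (tangent coordinate `s`), `x₀` is the depth in units of `λ`.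
[folklore] -/
def aff (x : 𝔼 2) : 𝔼 2 := pt2 (C.lam * (x 1 - 1 / 2)) (C.lam * x 0)

/-- The linear part of `aff`. [folklore] -/
def affLin : 𝔼 2 →L[ℝ] 𝔼 2 :=
  (EuclideanSpace.proj (1 : Fin 2)).smulRight (C.lam • pt2 1 0) +
    (EuclideanSpace.proj (0 : Fin 2)).smulRight (C.lam • pt2 0 1)

/-- The linear part applied. [folklore] -/
theorem affLin_apply (v : 𝔼 2) : C.affLin v = pt2 (C.lam * v 1) (C.lam * v 0) := by
  ext i
  fin_cases i <;> simp [affLin] <;> ring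

/-- `aff` is its value at `0` plus its linear part. [folklore] -/
theorem aff_eq (x : 𝔼 2) : C.aff x = pt2 (-(C.lam / 2)) 0 + C.affLin x := by
  rw [aff, affLin_apply, pt2_add, pt2_eq_pt2_iff]; constructor <;> ring

/-- `aff` has derivative `affLin`. [folklore] -/
theorem hasFDerivAt_aff (x : 𝔼 2) : HasFDerivAt C.aff C.affLin x := by
  have : C.aff = fun x ↦ pt2 (-(C.lam / 2)) 0 + C.affLin x := funext C.aff_eq
  rw [this]; exact C.affLin.hasFDerivAt.const_add _

/-- `aff` is `C^∞`. [folklore] -/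
theorem contDiff_aff : ContDiff ℝ ∞ C.aff := by
  have : C.aff = fun x ↦ pt2 (-(C.lam / 2)) 0 + C.affLin x := funext C.aff_eq
  rw [this]; exact contDiff_const.add C.affLin.contDiff

/-- The inverse of `aff`. [folklore] -/
def affInv (q : 𝔼 2) : 𝔼 2 := pt2 (q 1 / C.lam) (q 0 / C.lam + 1 / 2)

/-- The linear part of `affInv`. [folklore] -/
def affInvLin : 𝔼 2 →L[ℝ] 𝔼 2 :=
  (EuclideanSpace.proj (1 : Fin 2)).smulRight (C.lam⁻¹ • pt2 1 0) +
    (EuclideanSpace.proj (0 : Fin 2)).smulRight (C.lam⁻¹ • pt2 0 1)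

/-- The linear part of `affInv` applied. [folklore] -/
theorem affInvLin_apply (w : 𝔼 2) : C.affInvLin w = pt2 (w 1 / C.lam) (w 0 / C.lam) := by
  ext i
  fin_cases i <;> simp [affInvLin] <;> ring

/-- `affInv` is its value at `0` plus its linear part. [folklore] -/
theorem affInv_eq (q : 𝔼 2) : C.affInv q = pt2 0 (1 / 2) + C.affInvLin q := by
  rw [affInv, affInvLin_apply, pt2_add, pt2_eq_pt2_iff]; constructor <;> ring

/-- `affInv` has derivative `affInvLin`. [folklore] -/
theorem hasFDerivAt_affInv (q : 𝔼 2) : HasFDerivAt C.affInv C.affInvLin q := by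
  have : C.affInv = fun q ↦ pt2 0 (1 / 2) + C.affInvLin q := funext C.affInv_eq
  rw [this]; exact C.affInvLin.hasFDerivAt.const_add _

/-- `affInv` is `C^∞`. [folklore] -/
theorem contDiff_affInv : ContDiff ℝ ∞ C.affInv := by
  have : C.affInv = fun q ↦ pt2 0 (1 / 2) + C.affInvLin q := funext C.affInv_eq
  rw [this]; exact contDiff_const.add C.affInvLin.contDiff

/-- `aff ∘ affInv = id`. [folklore] -/
@[simp] theorem aff_affInv (q : 𝔼 2) : C.aff (C.affInv q) = q := by
  have hl := C.lam_pos.ne'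
  show pt2 (C.lam * ((q 0 / C.lam + 1 / 2) - 1 / 2)) (C.lam * (q 1 / C.lam)) = q
  conv_rhs => rw [← pt2_eta q]
  rw [pt2_eq_pt2_iff]
  constructor <;> field_simp; ring

/-- `affInv ∘ aff = id`. [folklore] -/
@[simp] theorem affInv_aff (x : 𝔼 2) : C.affInv (C.aff x) = x := by
  have hl := C.lam_pos.ne'
  show pt2 (C.lam * x 0 / C.lam) (C.lam * (x 1 - 1 / 2) / C.lam + 1 / 2) = x
  conv_rhs => rw [← pt2_eta x]
  rw [pt2_eq_pt2_iff]
  constructor <;> field_simp; ring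

/-- `affLin ∘ affInvLin = id`. [folklore] -/
@[simp] theorem affLin_affInvLin (w : 𝔼 2) : C.affLin (C.affInvLin w) = w := by
  have hl := C.lam_pos.ne'
  rw [affInvLin_apply, affLin_apply]
  show pt2 (C.lam * (w 0 / C.lam)) (C.lam * (w 1 / C.lam)) = w
  conv_rhs => rw [← pt2_eta w]
  rw [pt2_eq_pt2_iff]
  constructor <;> field_simp

/-- `aff` is injective. [folklore] -/
theorem aff_injective : Injective C.aff := fun x y h ↦ by
  have := congrArg C.affInv h; rwa [affInv_aff, affInv_aff] at this

/-- `affInv` is injective. [folklore] -/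
theorem affInv_injective : Injective C.affInv := fun x y h ↦ by
  have := congrArg C.aff h; rwa [aff_affInv, aff_affInv] at this

/-- `affLin` is injective. [folklore] -/
theorem affLin_injective : Injective C.affLin := by
  intro v w h
  rw [affLin_apply, affLin_apply, pt2_eq_pt2_iff] at h
  have hl := C.lam_pos
  have h1 : v 1 = w 1 := by nlinarith [h.1]
  have h0 : v 0 = w 0 := by nlinarith [h.2]
  rw [← pt2_eta v, ← pt2_eta w, h0, h1]

/-- `affInvLin` is injective. [folklore] -/
theorem affInvLin_injective : Injective C.affInvLin := fun v w h ↦ by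
  have := congrArg C.affLin h; rwa [affLin_affInvLin, affLin_affInvLin] at this

/-- Coordinates of `aff`. [folklore] -/
@[simp] theorem aff_apply_zero (x : 𝔼 2) : C.aff x 0 = C.lam * (x 1 - 1 / 2) := rfl
/-- Coordinates of `aff`. [folklore] -/
@[simp] theorem aff_apply_one (x : 𝔼 2) : C.aff x 1 = C.lam * x 0 := rfl
/-- Coordinates of `affInv`. [folklore] -/
@[simp] theorem affInv_apply_zero (q : 𝔼 2) : C.affInv q 0 = q 1 / C.lam := rfl
/-- Coordinates of `affInv`. [folklore] -/
@[simp] theorem affInv_apply_one (q : 𝔼 2) : C.affInv q 1 = q 0 / C.lam + 1 / 2 := rfl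

/-- **The open band square in plane coordinates**: `x ∈ squareNhd (1/4)` iff
`aff x ∈ {|s| < 3λ/4} × (-λ/4, 5λ/4)`. [folklore] -/
theorem mem_squareNhd_iff_aff (x : 𝔼 2) : x ∈ squareNhd (1 / 4 : ℝ) ↔
    C.aff x 0 ∈ Ioo (-(3 * C.lam / 4)) (3 * C.lam / 4) ∧ C.aff x 1 ∈ Ioo (-(C.lam / 4)) (5 * C.lam / 4) := by
  rw [mem_squareNhd_iff, Fin.forall_fin_two, aff_apply_zero, aff_apply_one]
  have hl := C.lam_pos
  constructor
  · rintro ⟨⟨h0, h0'⟩, ⟨h1, h1'⟩⟩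
    exact ⟨⟨by nlinarith, by nlinarith⟩, ⟨by nlinarith, by nlinarith⟩⟩
  · rintro ⟨⟨h0, h0'⟩, ⟨h1, h1'⟩⟩
    exact ⟨⟨by nlinarith, by nlinarith⟩, ⟨by nlinarith, by nlinarith⟩⟩

/-- The square in terms of `affInv`. [folklore] -/
theorem affInv_mem_squareNhd_iff (q : 𝔼 2) : C.affInv q ∈ squareNhd (1 / 4 : ℝ) ↔
    q 0 ∈ Ioo (-(3 * C.lam / 4)) (3 * C.lam / 4) ∧ q 1 ∈ Ioo (-(C.lam / 4)) (5 * C.lam / 4) := by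
  rw [C.mem_squareNhd_iff_aff, aff_affInv]

/-! ### The band map -/

/-- **The band**: `x ↦ toSphere (aff x)`. [folklore] -/
def band (x : 𝔼 2) : 𝕊 3 := C.toSphere (C.aff x)

/-- Pointwise formula. [folklore] -/
theorem band_apply (x : 𝔼 2) : C.band x = C.toSphere (C.aff x) := rfl

/-- The band on `affInv q`. [folklore] -/
@[simp] theorem band_affInv (q : 𝔼 2) : C.band (C.affInv q) = C.toSphere q := by
  rw [band_apply, aff_affInv]

/-- The band is `C^∞`. [folklore] -/
theorem contMDiff_band : ContMDiff 𝓘(ℝ, 𝔼 2) (𝓡 3) ∞ C.band :=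
  C.contMDiff_toSphere.comp C.contDiff_aff.contMDiff

/-- The band is injective. [folklore] -/
theorem band_injective : Injective C.band := C.toSphere_injective.comp C.aff_injective

/-- The derivative of the band read in `ℝ⁴`. [folklore] -/
theorem fderiv_coe_band_apply (x v : 𝔼 2) :
    fderiv ℝ (fun x ↦ ((C.band x : 𝕊 3) : 𝔼 4)) x v =
      fderiv ℝ coePsiSymm (C.planeMap (C.aff x)) (C.planeLin (C.affLin v)) := by
  have h := fderiv_comp x (C.contDiff_coe_toSphere.differentiable (by simp) (C.aff x))
    (C.contDiff_aff.differentiable (by simp) x)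
  change fderiv ℝ ((fun q ↦ ((C.toSphere q : 𝕊 3) : 𝔼 4)) ∘ C.aff) x v = _
  rw [h, (C.hasFDerivAt_aff x).fderiv, ContinuousLinearMap.comp_apply, fderiv_coe_toSphere_apply]

/-- The band is immersed: injective `mfderiv`. [folklore] -/
theorem injective_mfderiv_band (x : 𝔼 2) : Injective (mfderiv 𝓘(ℝ, 𝔼 2) (𝓡 3) C.band x) := by
  refine injective_mfderiv_of_injective_fderiv_coe C.contMDiff_band x ?_
  intro v w h
  rw [fderiv_coe_band_apply, fderiv_coe_band_apply] at h
  exact C.affLin_injective (C.planeLin_injective (injective_fderiv_coePsiSymm _ h))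

/-- Points of the band square are clean-region plane points: `|s| < ℓ` and `d > -ν`. [folklore] -/
theorem aff_clean {x : 𝔼 2} (hx : x ∈ squareNhd (1 / 4 : ℝ)) : |C.aff x 0| < C.ℓ ∧ -C.ν < C.aff x 1 := by
  have h := (C.mem_squareNhd_iff_aff x).1 hx
  have := C.lam_lt_ℓ; have := C.lam_lt_ν; have := C.lam_pos
  exact ⟨abs_lt.2 ⟨by linarith [h.1.1], by linarith [h.1.2]⟩, by linarith [h.2.1]⟩

/-- A lifted plane point lies in the band square image iff its `affInv` lies in the square.
[folklore] -/
theorem toSphere_mem_image_iff (q : 𝔼 2) :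
    C.toSphere q ∈ C.band '' squareNhd (1 / 4 : ℝ) ↔ C.affInv q ∈ squareNhd (1 / 4 : ℝ) := by
  constructor
  · rintro ⟨x, hx, h⟩
    rw [band_apply, C.toSphere_injective.eq_iff] at h
    rw [← h, affInv_aff]; exact hx
  · intro h; exact ⟨_, h, C.band_affInv q⟩

/-! ### The two arcs of the result inside the square -/

/-- The parameter of the lower arc: `u = -3λ/4 + t λ/2` (from the left end to the corner `s*`).
[folklore] -/
def uLow (t : ℝ) : ℝ := -(3 * C.lam / 4) + t * (C.lam / 2)

/-- The parameter of the upper arc: `u = λ/4 + t λ/2` (from the corner `-s*` to the right end).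
[folklore] -/
def uUp (t : ℝ) : ℝ := C.lam / 4 + t * (C.lam / 2)

/-- **The lower arc**: the final mushroom curve from the left end of the arc to the lower left
corner, in band coordinates. [folklore] -/
def lowerArc (t : ℝ) : 𝔼 2 := C.affInv (mush C.lam 1 (C.uLow t))

/-- **The upper arc**: the final mushroom curve from the corner `-s*` to the right end of the arc, in
band coordinates. [folklore] -/
def upperArc (t : ℝ) : 𝔼 2 := C.affInv (mush C.lam 1 (C.uUp t))

/-- `uLow 0 = -3λ/4`. [folklore] -/
@[simp] theorem uLow_zero : C.uLow 0 = -(3 * C.lam / 4) := by simp [uLow]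
/-- `uLow 1 = s*`. [folklore] -/
@[simp] theorem uLow_one : C.uLow 1 = sStar C.lam := by rw [uLow, sStar]; ring
/-- `uUp 0 = -s*`. [folklore] -/
@[simp] theorem uUp_zero : C.uUp 0 = -sStar C.lam := by rw [uUp, sStar]; ring
/-- `uUp 1 = 3λ/4`. [folklore] -/
@[simp] theorem uUp_one : C.uUp 1 = 3 * C.lam / 4 := by rw [uUp]; ring

/-- `uLow` maps `(0, 1)` into `(-3λ/4, s*)`. [folklore] -/
theorem uLow_mem {t : ℝ} (ht : t ∈ Ioo (0 : ℝ) 1) : C.uLow t ∈ Ioo (-(3 * C.lam / 4)) (sStar C.lam) := by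
  have := C.lam_pos; rw [uLow, sStar]; exact ⟨by nlinarith [ht.1], by nlinarith [ht.2]⟩

/-- `uUp` maps `(0, 1)` into `(-s*, 3λ/4)`. [folklore] -/
theorem uUp_mem {t : ℝ} (ht : t ∈ Ioo (0 : ℝ) 1) : C.uUp t ∈ Ioo (-sStar C.lam) (3 * C.lam / 4) := by
  have := C.lam_pos; rw [uUp, sStar]; exact ⟨by nlinarith [ht.1], by nlinarith [ht.2]⟩

/-- `uLow` is affine with derivative `λ/2`. [folklore] -/
theorem hasDerivAt_uLow (t : ℝ) : HasDerivAt C.uLow (C.lam / 2) t := by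
  unfold uLow; simpa using ((hasDerivAt_id' t).mul_const (C.lam / 2)).const_add (-(3 * C.lam / 4))

/-- `uUp` is affine with derivative `λ/2`. [folklore] -/
theorem hasDerivAt_uUp (t : ℝ) : HasDerivAt C.uUp (C.lam / 2) t := by
  unfold uUp; simpa using ((hasDerivAt_id' t).mul_const (C.lam / 2)).const_add (C.lam / 4)

/-- The lower arc is `C^∞`. [folklore] -/
theorem contDiff_lowerArc : ContDiff ℝ ∞ C.lowerArc :=
  C.contDiff_affInv.comp ((contDiff_mush_stage C.lam 1).comp
    (contDiff_const.add (contDiff_id.mul contDiff_const)))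

/-- The upper arc is `C^∞`. [folklore] -/
theorem contDiff_upperArc : ContDiff ℝ ∞ C.upperArc :=
  C.contDiff_affInv.comp ((contDiff_mush_stage C.lam 1).comp
    (contDiff_const.add (contDiff_id.mul contDiff_const)))

/-- The lower arc is injective. [folklore] -/
theorem lowerArc_injective : Injective C.lowerArc := by
  intro s t h
  have h1 := mush_injective C.lam_pos 1 (C.affInv_injective h)
  rw [uLow, uLow] at h1
  nlinarith [C.lam_pos]

/-- The upper arc is injective. [folklore] -/
theorem upperArc_injective : Injective C.upperArc := by
  intro s t h
  have h1 := mush_injective C.lam_pos 1 (C.affInv_injective h)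
  rw [uUp, uUp] at h1
  nlinarith [C.lam_pos]

/-- The derivative of the lower arc. [folklore] -/
theorem hasDerivAt_lowerArc (t : ℝ) :
    HasDerivAt C.lowerArc (C.affInvLin ((C.lam / 2) • deriv (mush C.lam 1) (C.uLow t))) t := by
  have hm : HasDerivAt (mush C.lam 1) (deriv (mush C.lam 1) (C.uLow t)) (C.uLow t) :=
    (((contDiff_mush_stage C.lam 1).differentiable (by simp)) _).hasDerivAt
  have h1 := hm.scomp t (C.hasDerivAt_uLow t)
  exact (C.hasFDerivAt_affInv _).comp_hasDerivAt t h1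

/-- The derivative of the upper arc. [folklore] -/
theorem hasDerivAt_upperArc (t : ℝ) :
    HasDerivAt C.upperArc (C.affInvLin ((C.lam / 2) • deriv (mush C.lam 1) (C.uUp t))) t := by
  have hm : HasDerivAt (mush C.lam 1) (deriv (mush C.lam 1) (C.uUp t)) (C.uUp t) :=
    (((contDiff_mush_stage C.lam 1).differentiable (by simp)) _).hasDerivAt
  have h1 := hm.scomp t (C.hasDerivAt_uUp t)
  exact (C.hasFDerivAt_affInv _).comp_hasDerivAt t h1

/-- The lower arc is regular. [folklore] -/
theorem deriv_lowerArc_ne_zero (t : ℝ) : deriv C.lowerArc t ≠ 0 := by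
  rw [(C.hasDerivAt_lowerArc t).deriv]
  intro h
  have h1 : (C.lam / 2) • deriv (mush C.lam 1) (C.uLow t) = 0 :=
    C.affInvLin_injective (h.trans (map_zero C.affInvLin).symm)
  rw [smul_eq_zero] at h1
  rcases h1 with h1 | h1
  · linarith [C.lam_pos]
  · exact deriv_mush_ne_zero C.lam_pos 1 _ h1

/-- The upper arc is regular. [folklore] -/
theorem deriv_upperArc_ne_zero (t : ℝ) : deriv C.upperArc t ≠ 0 := by
  rw [(C.hasDerivAt_upperArc t).deriv]
  intro h
  have h1 : (C.lam / 2) • deriv (mush C.lam 1) (C.uUp t) = 0 :=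
    C.affInvLin_injective (h.trans (map_zero C.affInvLin).symm)
  rw [smul_eq_zero] at h1
  rcases h1 with h1 | h1
  · linarith [C.lam_pos]
  · exact deriv_mush_ne_zero C.lam_pos 1 _ h1

/-- `lowerArc 0 = (0, -1/4)`. [folklore] -/
theorem lowerArc_zero : C.lowerArc 0 = pt2 0 (-(1 / 4)) := by
  have hl := C.lam_pos.ne'
  rw [lowerArc, uLow_zero, mush_of_le C.lam_pos 1 le_rfl, affInv, pt2_apply_zero, pt2_apply_one,
    pt2_eq_pt2_iff]
  constructor <;> field_simp <;> ring

/-- `lowerArc 1 = (1, -1/4)` (the lower left corner `s*`). [folklore] -/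
theorem lowerArc_one : C.lowerArc 1 = pt2 1 (-(1 / 4)) := by
  have hl := C.lam_pos.ne'
  rw [lowerArc, uLow_one, mush_one_sStar C.lam_pos, affInv, pt2_apply_zero, pt2_apply_one, pt2_eq_pt2_iff]
  constructor <;> field_simp; ring

/-- `upperArc 0 = (1, 5/4)`. [folklore] -/
theorem upperArc_zero : C.upperArc 0 = pt2 1 (1 + 1 / 4) := by
  have hl := C.lam_pos.ne'
  rw [upperArc, uUp_zero, mush_one_neg_sStar C.lam_pos, affInv, pt2_apply_zero, pt2_apply_one,
    pt2_eq_pt2_iff]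
  constructor <;> field_simp; ring

/-- `upperArc 1 = (0, 5/4)`. [folklore] -/
theorem upperArc_one : C.upperArc 1 = pt2 0 (1 + 1 / 4) := by
  have hl := C.lam_pos.ne'
  rw [upperArc, uUp_one, mush_of_ge C.lam_pos 1 le_rfl, affInv, pt2_apply_zero, pt2_apply_one,
    pt2_eq_pt2_iff]
  constructor <;> field_simp <;> ring

/-- The lower arc stays in the lower half of the square. [folklore] -/
theorem lowerArc_mem {t : ℝ} (ht : t ∈ Ioo (0 : ℝ) 1) :
    C.lowerArc t ∈ squareNhd (1 / 4 : ℝ) ∧ C.lowerArc t 1 < 2⁻¹ := by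
  have h := mush_one_mem_of_mem C.lam_pos (C.uLow_mem ht)
  have hl := C.lam_pos
  refine ⟨(C.affInv_mem_squareNhd_iff _).2 ⟨⟨h.1.1, by linarith [h.1.2]⟩, ⟨by linarith [h.2.1], by linarith [h.2.2]⟩⟩, ?_⟩
  rw [lowerArc, affInv_apply_one]
  have : mush C.lam 1 (C.uLow t) 0 / C.lam < 0 := div_neg_of_neg_of_pos h.1.2 hl
  linarith

/-- The upper arc stays in the upper half of the square. [folklore] -/
theorem upperArc_mem {t : ℝ} (ht : t ∈ Ioo (0 : ℝ) 1) :
    C.upperArc t ∈ squareNhd (1 / 4 : ℝ) ∧ 2⁻¹ < C.upperArc t 1 := by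
  have h := mush_one_mem_of_mem' C.lam_pos (C.uUp_mem ht)
  have hl := C.lam_pos
  refine ⟨(C.affInv_mem_squareNhd_iff _).2 ⟨⟨by linarith [h.1.1], h.1.2⟩, ⟨by linarith [h.2.1], by linarith [h.2.2]⟩⟩, ?_⟩
  rw [upperArc, affInv_apply_one]
  have : 0 < mush C.lam 1 (C.uUp t) 0 / C.lam := div_pos h.1.1 hl
  linarith

/-! ### The set-theoretic clauses -/

/-- **The left edge**: the knot meets the band square exactly in the line `x₀ = 0`. [folklore] -/
theorem preimage_left : C.band ⁻¹' range C.K ∩ squareNhd (1 / 4 : ℝ) = {x ∈ squareNhd (1 / 4 : ℝ) | x 0 = 0} := by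
  ext x
  simp only [mem_inter_iff, mem_preimage, mem_setOf_eq]
  constructor
  · rintro ⟨⟨y, hy⟩, hx⟩
    refine ⟨hx, ?_⟩
    obtain ⟨h1, -⟩ := C.eq_of_apply_eq_toSphere (C.aff_clean hx).1 (C.aff_clean hx).2 hy
    rw [aff_apply_one] at h1
    rcases mul_eq_zero.1 h1 with h | h
    · exact absurd h C.lam_pos.ne'
    · exact h
  · rintro ⟨hx, h0⟩
    refine ⟨?_, hx⟩
    have heq : C.aff x = pt2 (C.lam * (x 1 - 1 / 2)) 0 := by rw [aff, h0, mul_zero]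
    rw [band_apply, heq]
    have h1 := (C.mem_squareNhd_iff_aff x).1 hx
    rw [aff_apply_zero] at h1
    exact C.toSphere_pt2_mem_range
      ⟨by linarith [h1.1.1, C.lam_lt_ℓ, C.lam_pos], by linarith [h1.1.2, C.lam_lt_ℓ, C.lam_pos]⟩

/-- **The right edge**: the small unknot meets the band square exactly in the line `x₀ = 1`.
[folklore] -/
theorem preimage_right : C.band ⁻¹' range (C.oKnot 1) ∩ squareNhd (1 / 4 : ℝ) =
    {x ∈ squareNhd (1 / 4 : ℝ) | x 0 = 1} := by
  have h01 : (1 : ℝ) ∈ Icc (0 : ℝ) 1 := ⟨zero_le_one, le_rfl⟩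
  ext x
  simp only [mem_inter_iff, mem_preimage, mem_setOf_eq]
  constructor
  · rintro ⟨hy, hx⟩
    refine ⟨hx, ?_⟩
    obtain ⟨θ, hθ⟩ := (C.mem_range_oKnot_iff h01).1 hy
    rw [band_apply, C.toSphere_injective.eq_iff] at hθ
    have hsq := (C.mem_squareNhd_iff_aff x).1 hx
    rw [hθ] at hsq
    have h1 : |C.lam * cos θ| < 3 * C.lam / 4 := by
      rw [← dloop_apply_zero C.lam 1 θ]; exact abs_lt.2 ⟨hsq.1.1, hsq.1.2⟩
    have hs := one_half_lt_sin_of_mem_square C.lam_pos h1 hsq.2.2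
    have hd : dloop C.lam 1 θ 1 = C.lam := (dloop_one_apply_one_eq_iff C.lam_pos θ).2 hs.le
    rw [← hθ, aff_apply_one] at hd
    have := C.lam_pos
    field_simp at hd
    linarith
  · rintro ⟨hx, h0⟩
    refine ⟨?_, hx⟩
    have hsq := (C.mem_squareNhd_iff_aff x).1 hx
    have hs : |C.lam * (x 1 - 1 / 2)| ≤ 3 * C.lam / 4 := by
      rw [← aff_apply_zero]; exact (abs_lt.2 ⟨hsq.1.1, hsq.1.2⟩).le
    obtain ⟨hd, -⟩ := dloop_one_arccos C.lam_pos hs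
    have heq : C.aff x = pt2 (C.lam * (x 1 - 1 / 2)) C.lam := by rw [aff, h0, mul_one]
    rw [band_apply, heq, ← hd, C.mem_range_oKnot_iff h01]
    exact ⟨_, rfl⟩

/-- **Outside the square the result is the union of the knot and the small unknot.** [folklore] -/
theorem range_diff : range C.newKnot \ C.band '' squareNhd (1 / 4 : ℝ) =
    (range C.K ∪ range (C.oKnot 1)) \ C.band '' squareNhd (1 / 4 : ℝ) := by
  have h01 : (1 : ℝ) ∈ Icc (0 : ℝ) 1 := ⟨zero_le_one, le_rfl⟩
  have hL := C.lam_pos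
  ext y
  rw [mem_sdiff, mem_sdiff, mem_union]
  constructor
  · rintro ⟨hy, hyB⟩
    refine ⟨?_, hyB⟩
    rcases (C.mem_range_newKnot_iff y).1 hy with ⟨θ, hθ, rfl⟩ | ⟨x, -, rfl⟩
    · set u := C.σ θ with hu
      by_cases hbig : 3 * C.lam / 4 ≤ |u|
      · left
        rw [mush_of_le_abs hL 1 hbig, hu, ← C.apply_circlePoint_eq_toSphere hθ]; exact ⟨_, rfl⟩
      push Not at hbig
      have hu3 : u ∈ Ioo (-(3 * C.lam / 4)) (3 * C.lam / 4) := abs_lt.1 hbig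
      by_cases hlo : u < sStar C.lam
      · exfalso
        have h := mush_one_mem_of_mem hL ⟨hu3.1, hlo⟩
        exact hyB ((C.toSphere_mem_image_iff _).2 ((C.affInv_mem_squareNhd_iff _).2
          ⟨⟨h.1.1, by linarith [h.1.2]⟩, ⟨by linarith [h.2.1], by linarith [h.2.2]⟩⟩))
      by_cases hhi : -sStar C.lam < u
      · exfalso
        have h := mush_one_mem_of_mem' hL ⟨hhi, hu3.2⟩
        exact hyB ((C.toSphere_mem_image_iff _).2 ((C.affInv_mem_squareNhd_iff _).2
          ⟨⟨by linarith [h.1.1], h.1.2⟩, ⟨by linarith [h.2.1], by linarith [h.2.2]⟩⟩))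
      · right
        push Not at hlo hhi
        have hum : u ∈ Icc (u1 C.lam) (-u1 C.lam) :=
          ⟨(u1_lt_sStar hL).le.trans hlo, hhi.trans (by linarith [u1_lt_sStar hL])⟩
        rw [mush_one_eq_dloop hL hum, C.mem_range_oKnot_iff h01]
        exact ⟨_, rfl⟩
    · left; exact ⟨x, rfl⟩
  · rintro ⟨hy, hyB⟩
    refine ⟨?_, hyB⟩
    rcases hy with ⟨x, rfl⟩ | hy
    · rcases C.newKnot_eq_or x with ⟨θ, hθ, rfl⟩ | h
      · have hbig : 3 * C.lam / 4 ≤ |C.σ θ| := by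
          by_contra hlt; push Not at hlt
          apply hyB
          rw [C.apply_circlePoint_eq_toSphere hθ, C.toSphere_mem_image_iff, C.affInv_mem_squareNhd_iff]
          refine ⟨?_, ?_⟩
          · change C.σ θ ∈ Ioo _ _; exact abs_lt.1 hlt
          · change (0 : ℝ) ∈ Ioo _ _; exact ⟨by linarith, by linarith⟩
        refine ⟨circlePoint θ, ?_⟩
        rw [C.newKnot_circlePoint_of_mem hθ, mush_of_le_abs hL 1 hbig, C.apply_circlePoint_eq_toSphere hθ]
      · exact ⟨x, h⟩
    · obtain ⟨φ, rfl⟩ := (C.mem_range_oKnot_iff h01).1 hy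
      rcases dloop_one_dichotomy hL φ with ⟨u, hu, heq⟩ | ⟨hc, hs⟩
      · have huℓ : u ∈ Icc (-C.ℓ) C.ℓ := by
          rw [sStar] at hu
          exact ⟨by linarith [hu.1, C.lam_lt_ℓ], by linarith [hu.2, C.lam_lt_ℓ]⟩
        refine ⟨circlePoint (C.θOf u), ?_⟩
        rw [C.newKnot_circlePoint_of_mem (C.θOf_mem huℓ), C.σ_θOf huℓ, ← heq]
      · exfalso
        apply hyB
        rw [C.toSphere_mem_image_iff, C.affInv_mem_squareNhd_iff, dloop_apply_zero,
          (dloop_one_apply_one_eq_iff hL φ).2 hs.le]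
        exact ⟨abs_lt.1 hc, ⟨by linarith, by linarith⟩⟩

/-- **Inside the square the result is the two arcs.** [folklore] -/
theorem preimage_range : C.band ⁻¹' range C.newKnot ∩ squareNhd (1 / 4 : ℝ) =
    C.lowerArc '' Ioo 0 1 ∪ C.upperArc '' Ioo 0 1 := by
  have hL := C.lam_pos
  ext x
  simp only [mem_inter_iff, mem_preimage, mem_union, mem_image]
  constructor
  · rintro ⟨hy, hx⟩
    rcases (C.mem_range_newKnot_iff _).1 hy with ⟨θ, hθ, heq⟩ | ⟨x', hx', heq⟩
    · rw [band_apply, C.toSphere_injective.eq_iff] at heq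
      set u := C.σ θ with hu
      have hsq := (C.mem_squareNhd_iff_aff x).1 hx
      rw [heq] at hsq
      have hsmall : |u| < 3 * C.lam / 4 := by
        by_contra hle; push Not at hle
        rw [mush_of_le_abs hL 1 hle, pt2_apply_zero] at hsq
        exact (abs_lt.2 ⟨hsq.1.1, hsq.1.2⟩).not_ge hle
      have hu3 := abs_lt.1 hsmall
      have hnot : ¬(sStar C.lam ≤ u ∧ u ≤ -sStar C.lam) := by
        rintro ⟨h1, h2⟩
        exact mush_one_not_mem_square hL ⟨h1, h2⟩ ⟨abs_lt.2 ⟨hsq.1.1, hsq.1.2⟩, hsq.2.2⟩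
      rcases lt_or_ge u (sStar C.lam) with hlo | hlo
      · left
        refine ⟨(u + 3 * C.lam / 4) / (C.lam / 2), ⟨?_, ?_⟩, ?_⟩
        · exact div_pos (by linarith [hu3.1]) (by linarith)
        · rw [div_lt_one (by linarith), sStar] at *; linarith
        · have : -(3 * C.lam / 4) + (u + 3 * C.lam / 4) / (C.lam / 2) * (C.lam / 2) = u := by
            field_simp; ring
          rw [lowerArc, uLow, this, ← heq, affInv_aff]
      · right
        have hhi : -sStar C.lam < u := lt_of_not_ge fun h ↦ hnot ⟨hlo, h⟩
        refine ⟨(u - C.lam / 4) / (C.lam / 2), ⟨?_, ?_⟩, ?_⟩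
        · rw [sStar] at hhi; exact div_pos (by linarith) (by linarith)
        · rw [div_lt_one (by linarith)]; linarith [hu3.2]
        · have : C.lam / 4 + (u - C.lam / 4) / (C.lam / 2) * (C.lam / 2) = u := by
            field_simp; ring
          rw [upperArc, uUp, this, ← heq, affInv_aff]
    · exfalso
      exact C.not_window_of_apply_eq_toSphere hx' (C.aff_clean hx).1 (C.aff_clean hx).2 heq.symm
  · rintro (⟨t, ht, rfl⟩ | ⟨t, ht, rfl⟩)
    · refine ⟨?_, (C.lowerArc_mem ht).1⟩
      have hu := C.uLow_mem ht
      have huℓ : C.uLow t ∈ Icc (-C.ℓ) C.ℓ := by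
        rw [sStar] at hu; exact ⟨by linarith [hu.1, C.lam_lt_ℓ], by linarith [hu.2, C.lam_lt_ℓ]⟩
      rw [lowerArc, band_affInv]
      exact ⟨circlePoint (C.θOf (C.uLow t)), by rw [C.newKnot_circlePoint_of_mem (C.θOf_mem huℓ), C.σ_θOf huℓ]⟩
    · refine ⟨?_, (C.upperArc_mem ht).1⟩
      have hu := C.uUp_mem ht
      have huℓ : C.uUp t ∈ Icc (-C.ℓ) C.ℓ := by
        rw [sStar] at hu; exact ⟨by linarith [hu.1, C.lam_lt_ℓ, C.lam_pos], by linarith [hu.2, C.lam_lt_ℓ]⟩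
      rw [upperArc, band_affInv]
      exact ⟨circlePoint (C.θOf (C.uUp t)), by rw [C.newKnot_circlePoint_of_mem (C.θOf_mem huℓ), C.σ_θOf huℓ]⟩

/-! ### The orientation clauses -/

/-- A tangent coordinate strictly inside `(-ℓ, ℓ)` has its parameter strictly inside the window.
[folklore] -/
theorem θOf_mem_Ioo {s : ℝ} (hs : s ∈ Ioo (-C.ℓ) C.ℓ) : C.θOf s ∈ Ioo C.α C.β := by
  have hs' : s ∈ Icc (-C.ℓ) C.ℓ := Ioo_subset_Icc_self hs
  have hm := C.θOf_mem hs'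
  refine ⟨lt_of_le_of_ne hm.1 fun h ↦ ?_, lt_of_le_of_ne hm.2 fun h ↦ ?_⟩
  · have := C.σ_θOf hs'; rw [← h, C.σ_α] at this; linarith [hs.1]
  · have := C.σ_θOf hs'; rw [h, C.σ_β] at this; linarith [hs.2]

/-- Near an interior window parameter the knot is the lifted straight arc. [folklore] -/
theorem coe_apply_circlePoint_eventuallyEq {θ : ℝ} (hθ : θ ∈ Ioo C.α C.β) :
    (fun t ↦ ((C.K (circlePoint t) : 𝕊 3) : 𝔼 4)) =ᶠ[𝓝 θ]
      fun t ↦ ((C.toSphere (pt2 (C.σ t) 0) : 𝕊 3) : 𝔼 4) := by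
  filter_upwards [Ioo_mem_nhds hθ.1 hθ.2] with t ht
  rw [C.apply_circlePoint_eq_toSphere (Ioo_subset_Icc_self ht)]

/-- Near an interior window parameter the new knot is the lifted mushroom. [folklore] -/
theorem coe_newKnot_circlePoint_eventuallyEq {θ : ℝ} (hθ : θ ∈ Ioo C.α C.β) :
    (fun t ↦ ((C.newKnot (circlePoint t) : 𝕊 3) : 𝔼 4)) =ᶠ[𝓝 θ]
      fun t ↦ ((C.toSphere (mush C.lam 1 (C.σ t)) : 𝕊 3) : 𝔼 4) := by
  filter_upwards [Ioo_mem_nhds hθ.1 hθ.2] with t ht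
  rw [C.newKnot_circlePoint_of_mem (Ioo_subset_Icc_self ht)]

/-- The derivative of `t ↦ (σ t, 0)`. [folklore] -/
theorem hasDerivAt_pt2_σ (θ : ℝ) : HasDerivAt (fun t ↦ pt2 (C.σ t) 0) ((deriv C.σ θ) • pt2 1 0) θ := by
  have h := hasDerivAt_pt2 ((C.differentiable_σ θ).hasDerivAt) (hasDerivAt_const θ (0 : ℝ))
  rw [smul_pt2, mul_one, mul_zero]
  exact h

/-- **Orientation of the knot along the left edge**: at the base parameter the velocity of `K` is
`(σ'/λ)` times `∂band/∂x₁`. [folklore] -/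
theorem orient_left : ∃ θ c : ℝ, 0 < c ∧ C.K (circlePoint θ) = C.band (pt2 0 2⁻¹) ∧
    deriv (fun t ↦ ((C.K (circlePoint t) : 𝕊 3) : 𝔼 4)) θ =
      c • fderiv ℝ (fun x ↦ ((C.band x : 𝕊 3) : 𝔼 4)) (pt2 0 2⁻¹) (pt2 0 1) := by
  have h0 : (0 : ℝ) ∈ Ioo (-C.ℓ) C.ℓ := ⟨by linarith [C.ℓ_pos], C.ℓ_pos⟩
  have h0' : (0 : ℝ) ∈ Icc (-C.ℓ) C.ℓ := Ioo_subset_Icc_self h0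
  set θ := C.θOf 0 with hθ
  have hθm := C.θOf_mem_Ioo h0
  have haff : C.aff (pt2 0 2⁻¹) = pt2 0 0 := by
    rw [aff, pt2_apply_zero, pt2_apply_one, pt2_eq_pt2_iff]; constructor <;> ring
  refine ⟨θ, deriv C.σ θ / C.lam, div_pos (C.deriv_σ_pos θ (Ioo_subset_Icc_self hθm)) C.lam_pos, ?_, ?_⟩
  · rw [band_apply, haff, C.apply_circlePoint_eq_toSphere (Ioo_subset_Icc_self hθm), C.σ_θOf h0']
  · rw [(C.coe_apply_circlePoint_eventuallyEq hθm).deriv_eq,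
      C.deriv_coe_toSphere_comp ((C.hasDerivAt_pt2_σ θ).differentiableAt),
      (C.hasDerivAt_pt2_σ θ).deriv, C.σ_θOf h0', fderiv_coe_band_apply, haff, affLin_apply,
      pt2_apply_zero, pt2_apply_one, mul_one, mul_zero, map_smul, map_smul,
      show pt2 C.lam 0 = C.lam • pt2 (1 : ℝ) 0 by rw [smul_pt2, mul_one, mul_zero],
      map_smul, map_smul, smul_smul, div_mul_cancel₀ _ C.lam_pos.ne']

/-- **Orientation of the small unknot along the right edge**: at the top point `φ = π/2` the
velocity of `O` equals `∂band/∂(-x₁)`. [folklore] -/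
theorem orient_right : ∃ θ c : ℝ, 0 < c ∧ C.oKnot 1 (circlePoint θ) = C.band (pt2 1 2⁻¹) ∧
    deriv (fun t ↦ ((C.oKnot 1 (circlePoint t) : 𝕊 3) : 𝔼 4)) θ =
      c • fderiv ℝ (fun x ↦ ((C.band x : 𝕊 3) : 𝔼 4)) (pt2 1 2⁻¹) (pt2 0 (-1)) := by
  have h01 : (1 : ℝ) ∈ Icc (0 : ℝ) 1 := ⟨zero_le_one, le_rfl⟩
  have haff : C.aff (pt2 1 2⁻¹) = pt2 0 C.lam := by
    rw [aff, pt2_apply_zero, pt2_apply_one, pt2_eq_pt2_iff]; constructor <;> ring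
  have hfun : (fun t ↦ ((C.oKnot 1 (circlePoint t) : 𝕊 3) : 𝔼 4)) =
      fun t ↦ ((C.toSphere (dloop C.lam 1 t) : 𝕊 3) : 𝔼 4) := by
    funext t; rw [C.oKnot_circlePoint h01]
  refine ⟨π / 2, 1, one_pos, ?_, ?_⟩
  · rw [band_apply, haff, C.oKnot_circlePoint h01, dloop_one_pi_div_two C.lam_pos]
  · rw [hfun, C.deriv_coe_toSphere_comp (((contDiff_dloop_stage C.lam 1).differentiable (by simp)) _),
      deriv_dloop_one_pi_div_two, dloop_one_pi_div_two C.lam_pos, one_smul, fderiv_coe_band_apply,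
      haff, affLin_apply, pt2_apply_zero, pt2_apply_one, mul_neg, mul_one, mul_zero]

/-- **Orientation of the result along the lower arc**: at the parameter of tangent coordinate
`-λ/2` the velocity of `K # O` is `(2σ'/λ)` times the image of the velocity of `lowerArc`.
[folklore] -/
theorem orient_result : ∃ θ c : ℝ, 0 < c ∧ C.newKnot (circlePoint θ) = C.band (C.lowerArc 2⁻¹) ∧
    deriv (fun t ↦ ((C.newKnot (circlePoint t) : 𝕊 3) : 𝔼 4)) θ =
      c • fderiv ℝ (fun x ↦ ((C.band x : 𝕊 3) : 𝔼 4)) (C.lowerArc 2⁻¹) (deriv C.lowerArc 2⁻¹) := by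
  have hL := C.lam_pos
  have hu : C.uLow 2⁻¹ = -(C.lam / 2) := by rw [uLow]; ring
  have hm : -(C.lam / 2) ∈ Ioo (-C.ℓ) C.ℓ := ⟨by linarith [C.lam_lt_ℓ], by linarith [C.ℓ_pos]⟩
  have hm' := Ioo_subset_Icc_self hm
  set θ := C.θOf (-(C.lam / 2)) with hθ
  have hθm := C.θOf_mem_Ioo hm
  refine ⟨θ, deriv C.σ θ / (C.lam / 2), div_pos (C.deriv_σ_pos θ (Ioo_subset_Icc_self hθm)) (by linarith),
    ?_, ?_⟩
  · rw [lowerArc, band_affInv, C.newKnot_circlePoint_of_mem (Ioo_subset_Icc_self hθm), C.σ_θOf hm', hu]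
  · have hmd : HasDerivAt (mush C.lam 1) (deriv (mush C.lam 1) (-(C.lam / 2))) (C.σ θ) := by
      rw [C.σ_θOf hm']; exact (((contDiff_mush_stage C.lam 1).differentiable (by simp)) _).hasDerivAt
    have hcomp : HasDerivAt (fun t ↦ mush C.lam 1 (C.σ t)) (deriv C.σ θ • deriv (mush C.lam 1) (-(C.lam / 2))) θ :=
      hmd.scomp θ (C.differentiable_σ θ).hasDerivAt
    rw [(C.coe_newKnot_circlePoint_eventuallyEq hθm).deriv_eq, C.deriv_coe_toSphere_comp hcomp.differentiableAt,
      hcomp.deriv, C.σ_θOf hm', fderiv_coe_band_apply, (C.hasDerivAt_lowerArc _).deriv, hu, affLin_affInvLin,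
      lowerArc, aff_affInv, hu, map_smul, map_smul, map_smul, map_smul, smul_smul,
      div_mul_cancel₀ _ (by linarith : C.lam / 2 ≠ 0)]

/-! ### The band data and the connected sum -/

/-- **The band data of `K # O`**: band the affine square below the flat arc, collar `1/4`, arcs read
off from the final mushroom curve. [folklore] -/
def bandData : BandData C.K (C.oKnot 1) C.newKnot ∅ where
  band := C.band
  δ := 1 / 4
  δ_pos := by norm_num
  contMDiff := C.contMDiff_band
  injOn := C.band_injective.injOn
  injective_mfderiv x _ := C.injective_mfderiv_band x
  disjoint_avoid := Set.disjoint_empty _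
  preimage_left := C.preimage_left
  preimage_right := C.preimage_right
  range_diff := C.range_diff
  lowerArc := C.lowerArc
  upperArc := C.upperArc
  contDiff_lowerArc := C.contDiff_lowerArc
  contDiff_upperArc := C.contDiff_upperArc
  injOn_lowerArc := C.lowerArc_injective.injOn
  injOn_upperArc := C.upperArc_injective.injOn
  deriv_lowerArc_ne_zero t _ := C.deriv_lowerArc_ne_zero t
  deriv_upperArc_ne_zero t _ := C.deriv_upperArc_ne_zero t
  lowerArc_zero := by rw [C.lowerArc_zero]
  lowerArc_one := by rw [C.lowerArc_one]
  upperArc_zero := by rw [C.upperArc_zero]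
  upperArc_one := by rw [C.upperArc_one]
  lowerArc_mem t ht := C.lowerArc_mem ht
  upperArc_mem t ht := C.upperArc_mem ht
  preimage_range := C.preimage_range
  orient_left := C.orient_left
  orient_right := C.orient_right
  orient_result := C.orient_result

section WithO

variable [SphereEmbedding.SmoothnessFacts]

/-- **The crossing condition**: the band meets the splitting sphere exactly in its middle segment
`x₀ = 1/2`. [folklore] -/
theorem crossing : C.bandData.band ⁻¹' range C.sphereS ∩ squareNhd C.bandData.δ =
    {x ∈ squareNhd C.bandData.δ | x 0 = 2⁻¹} := by
  change C.band ⁻¹' range C.sphereS ∩ squareNhd (1 / 4 : ℝ) = {x ∈ squareNhd (1 / 4 : ℝ) | x 0 = 2⁻¹}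
  have hL := C.lam_pos
  ext x
  simp only [mem_inter_iff, mem_preimage, mem_setOf_eq]
  constructor
  · rintro ⟨hy, hx⟩
    refine ⟨hx, ?_⟩
    have hsq := (C.mem_squareNhd_iff_aff x).1 hx
    rw [band_apply, C.toSphere_mem_range_sphereS_iff (abs_le.2 ⟨by linarith [hsq.1.1], by linarith [hsq.1.2]⟩)
      (abs_le.2 ⟨by linarith [hsq.2.1], by linarith [hsq.2.2]⟩), aff_apply_one] at hy
    field_simp at hy
    linarith
  · rintro ⟨hx, h0⟩
    refine ⟨?_, hx⟩
    have hsq := (C.mem_squareNhd_iff_aff x).1 hx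
    rw [band_apply, C.toSphere_mem_range_sphereS_iff (abs_le.2 ⟨by linarith [hsq.1.1], by linarith [hsq.1.2]⟩)
      (abs_le.2 ⟨by linarith [hsq.2.1], by linarith [hsq.2.2]⟩), aff_apply_one, h0]
    ring

/-- **`K # O` is a connected sum of `K` and the unknot** for every knot `K` isotopic to the
flat-arc copy `C.K`. [cite: Rolfsen1976, §2.G] -/
theorem isConnectedSum {K : Knot} (hK : K.IsIsotopic C.K) : Knot.IsConnectedSum K unknot C.newKnot :=
  ⟨C.K, C.oKnot 1, hK, C.unknot_isIsotopic_oKnot_one, C.sphereS, C.bandData, C.isSplitBy_sphereS, C.crossing⟩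

end WithO

end FlatArcConfig

end BandSumUnit

/-- **The unknot is a unit for the connected sum** — discharge of the named fact
`Knot.exists_isConnectedSum_unknot_isIsotopic` (`BandSum.lean`): for every knot `K` there is a
connected sum `K # O` with the unknot isotopic to `K`. Take a flat-arc copy `C.K ≃ K`
(`BandSumUnit.FlatArcConfig.exists`), tie a small unknot `O` to the flat arc along an explicit band
(`FlatArcConfig.isConnectedSum`), and deform `C.K` into `K # O` by the explicit family of simple
closed curves of `BandSumUnitFamily.lean` (`FlatArcConfig.isIsotopic_newKnot`). Rolfsen, *Knots and
Links* (1976), §2.G; Burde–Zieschang, *Knots*, §7.A. [cite: Rolfsen1976, §2.G] -/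
theorem Knot.exists_isConnectedSum_unknot_isIsotopic_holds : Knot.exists_isConnectedSum_unknot_isIsotopic := by
  intro _ K
  obtain ⟨C, hKC⟩ := BandSumUnit.FlatArcConfig.exists K
  exact ⟨C.newKnot, C.isConnectedSum hKC, SphereEmbedding.IsIsotopic.trans_holds hKC C.isIsotopic_newKnot⟩

end Literature.Topology.FourManifolds
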